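import Mathlib
import Literature.MathematicalPhysics.QuantumFieldTheory.Balaban1983to89.B14

/-!
# Beta / B14LiteralNoGo — BINDER-OWNERS row D4, co-owner road P2: the LITERAL form of the technique «bound each [P-apex]
# remainder leaf of the β-remainder by the printed B14/B16 remainder estimates» is VOID — a kernel «witness of weakness»
# (β sub-cell, unit `b2b-balaban-beta-d4-p2`, generation 1; leaf N0 of `HOME/beta/skeletons/D4-b2b-balaban-beta-d4-p2.md`)

HONEST FRAMING (page 1 of everything the β sub-cell writes): discharging `BetaPertH` makes Bałaban's UV stability
UNCONDITIONAL — a real constructive-QFT result; it is NOT the continuum limit and NOT the Clay problem.  HONEST DEPENDENCY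
(cell reorg 2026-08-19, verbatim): «continuum YM on T⁴ ⇐ BetaPertH ∧ nine spine estimates (0/9 proved); BetaPertH ⇐ (D1) ∧
(D4) ∧ CAP+tail; G-an2-4 gates asym, D1 and NE2/3/4.»  THIS MODULE INSTANTIATES NO BINDER AND SAYS NOTHING ABOUT BAŁABAN'S
β-FUNCTIONS: it is a fact about what a CLASS of printed bounds can and cannot imply, of the same kind as
`Summit.QuantumFields.BalabanUV.Beta.RemainderThresholdSharp` (row owner an4) and `FlowStepRuns.sign_not_necessary`.

ABSOLUTE RULE (cell charter, verbatim): "No internally-minted statement may enter as a cited fact. Every hypothesis is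
either kernel-proved in this package or a verbatim quotation of a PUBLISHED theorem with page reference. The manuscript(s)
under audit are NOT citable for their own disputed steps — they are the thing under adjudication; programme-internal
(2001/route/tribunal) claims are never citable."  Nothing is cited as a fact in this file; the one imported printed object is
the DEFINITION (2.28) of [Balaban1988Convergent] (= [III], cell paper B14, CMP **119** (1988) 243–285), typed verbatim as
`Literature.MathematicalPhysics.QuantumFieldTheory.Balaban1983to89.B14.alphaJ` (reader unit r2, p176040).

## What is recorded here, and why it matters for row D4

Row D4 of `HOME/BINDER-OWNERS.md` = the binder pair `(hrem : RemainderConst Sβ γ₀ rr) (hr : rr ≤ stepBal N Lc)` of the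
β wall's END: a k-UNIFORM bound on the beyond-one-loop part β¹_{k+1} of Bałaban's β-functions.  β is READ OUT of the
small-field effective-action terms by TWO field derivatives at zero field: [Balaban1987RG1] (= [I]) (1.20)–(1.22) p. 264
(«β_{j+1}(g_j) = … = Σ_x Π_{j+1,μν}(g_j, x)x_μx_ν (1.22)», Π the vacuum-polarization kernel (1.20)), restated in [III]
(3.50) p. 280 «Π_{μν}(x, y, z) = δ²/δB_μ(x)δB_ν(y) 𝐄^{(j)}(X, U_j exp(iB), z)|_{B=0}» and (3.61)–(3.64) pp. 282–283 («The
last identity can be considered as a possible definition of the β-function. Now we prove that it coincides with the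
definition (I.1.22).»).

The co-owner's assigned technique (coordinator, 2026-08-20T04:09Z) reads: «bound each [P-apex] remainder leaf by the
printed B14/B16 remainder estimates with explicit constants».  What [III]/[V] PRINT as bounds on the effective-action
terms are SUP bounds on analyticity spaces — [III] p. 259 (2.27)(iv) «it satisfies the inequality (I.1.18)», i.e.
`|𝐄^{(j)}(X,(𝐔,𝐉),z)| ≤ E₀ exp(−κd_j(X))` on `𝐔ᶜ_j(X, α_{0,j}, α_{1,j})` — whose RADII are, verbatim (2.28) p. 259,
«α_{0,j} = g_jC₀(log g_j^{−2})^{q₀}, α_{1,j} = g_jC₁(log g_j^{−2})^{q₁}, where q₀, q₁ are integers greater than 1, C₀, C₁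
are sufficiently large positive numbers», i.e. PROPORTIONAL TO g_j; and the one printed estimate with an explicit coupling
factor, [III] p. 278 ll. 15–18 (page render read as an image by this seat): «The terms of the sum above satisfy the bounds
(2.42), with the constant B₀ replaced by O(p₀³(g_k)). Of course the integration with respect to t preserves the form of
the representation, and the multiplication by g_k yields small bounds.» (p₀(g) = A₀(log g^{−2})^{p₀}, (2.4) p. 255).

§1–§2 (pure complex analysis): from «f analytic, ‖f‖ ≤ E₀ on the closed ball of radius α» NOTHING better than Cauchy's
`‖f''(0)‖ ≤ 2E₀/α²` can be concluded about the second derivative — the witness is `f(z) = E₀(z/α)²` (`cauchyWitness`,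
`iteratedDeriv_two_cauchyWitness`, `readoutBound_ge`).  §3 (real analysis in [III]'s letters): along [III]'s radii
`α = alphaJ C₀ q₀ g` and ANY budget of the printed shape `E₀(g) = g·c·(log g^{−2})^p` (p = 3p₀ is (E2) above; p = 0 is
(I.1.18) itself) the sharp value `2E₀(g)/α(g)²` is UNBOUNDED as g → 0⁺ (`sharpRatio_eq_param`, `tendsto_sharpRatio_param`,
`sharpRatio_unbounded`).  §4 combines them (`no_uniform_readout_from_B14_bounds`): NO rule that is valid on the class
«analytic, sup ≤ E₀ on radius α» yields, when fed [III]'s (E₀(g_k), α_{0,k}), a bound on the two-derivative read-out that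
stays bounded as g_k → 0 — let alone one below `stepBal N Lc`.  Hence no D4 leaf can be «bounded by the printed B14 remainder
estimates»: the literal technique is void, for a LOCATED reason ((2.28)), not for want of effort.  [V] = [Balaban1989LargeFieldII]
(1.100) p. 390 and [III] (2.31) p. 260 / (2.42) p. 261 bound 𝐑- and 𝐁-terms, which do not enter (1.22) at all ([III] p. 278
ll. −6…−2: the β-relevant terms «coincide with the corresponding terms arising from the expressions defined on the whole
lattice, i.e. in the framework of [I]»), so they are not a source either.  Road P1 (row owner an4) escapes §3 only because
[I]'s radii α₀, α₁, α₂ are ABSOLUTE ([I] Thm 3 p. 264; (4.4) p. 281), and so does the co-owner's surviving variant P2′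
(skeleton §2), which imports [III]'s DEVICES ((3.30) t·g_k interpolation, (3.16) cut-off) into [I]'s framework instead of
[III]'s bounds.

NOT CLAIMED.  Nothing about Bałaban's actual E-terms (whose true second field-derivatives are of course finite and small —
the point is that [III]'s PRINTED bounds do not show it); nothing of `BetaPertH`; NOT continuum, NOT Clay, NOT summit
progress.  Value = the negative half of the co-owner's repair census, as a kernel certificate.
-/

namespace Summit.QuantumFields.BalabanUV.Beta.B14LiteralNoGo

open Literature.MathematicalPhysics.QuantumFieldTheory.Balaban1983to89
open Filter Topology

noncomputable section

/-! ## §1 Cauchy's estimate for the second derivative is SHARP on the class «analytic, sup ≤ E₀ on radius α» -/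

/-- The extremal function for Cauchy's second-derivative estimate on the ball of radius `α` with sup bound `E₀`:
`z ↦ E₀·(z/α)²`, written as `(E₀/α²)·z²`. -/
def cauchyWitness (E₀ α : ℝ) (z : ℂ) : ℂ := ((E₀ / α ^ 2 : ℝ) : ℂ) * z ^ 2

/-- The witness is an entire function. -/
theorem analyticOnNhd_cauchyWitness (E₀ α : ℝ) : AnalyticOnNhd ℂ (cauchyWitness E₀ α) Set.univ := by
  intro z _
  unfold cauchyWitness
  exact analyticAt_const.mul ((analyticAt_id).pow 2)

/-- On the closed ball of radius `α` the witness is bounded by `E₀`. -/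
theorem norm_cauchyWitness_le {E₀ α : ℝ} (hE : 0 ≤ E₀) (hα : 0 < α) {z : ℂ} (hz : ‖z‖ ≤ α) :
    ‖cauchyWitness E₀ α z‖ ≤ E₀ := by
  unfold cauchyWitness
  rw [norm_mul, Complex.norm_real, norm_pow, Real.norm_eq_abs, abs_of_nonneg (by positivity)]
  have h1 : ‖z‖ ^ 2 ≤ α ^ 2 := pow_le_pow_left₀ (norm_nonneg z) hz 2
  calc E₀ / α ^ 2 * ‖z‖ ^ 2 ≤ E₀ / α ^ 2 * α ^ 2 := by
        exact mul_le_mul_of_nonneg_left h1 (by positivity)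
    _ = E₀ := by field_simp

/-- First derivative of the witness: `z ↦ (E₀/α²)·(2z)`. -/
theorem deriv_cauchyWitness (E₀ α : ℝ) :
    deriv (cauchyWitness E₀ α) = fun z => ((E₀ / α ^ 2 : ℝ) : ℂ) * (2 * z) := by
  funext z
  unfold cauchyWitness
  have h : HasDerivAt (fun w : ℂ => ((E₀ / α ^ 2 : ℝ) : ℂ) * w ^ 2) (((E₀ / α ^ 2 : ℝ) : ℂ) * (2 * z)) z := by
    have hp : HasDerivAt (fun w : ℂ => w ^ 2) ((2 : ℕ) * z ^ (2 - 1)) z := hasDerivAt_pow 2 z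
    have hp' : HasDerivAt (fun w : ℂ => w ^ 2) (2 * z) z := by simpa using hp
    exact hp'.const_mul _
  exact h.deriv

/-- Second derivative of the witness at `0`: `2E₀/α²`. -/
theorem iteratedDeriv_two_cauchyWitness (E₀ α : ℝ) :
    iteratedDeriv 2 (cauchyWitness E₀ α) 0 = ((2 * E₀ / α ^ 2 : ℝ) : ℂ) := by
  rw [show (2 : ℕ) = 1 + 1 from rfl, iteratedDeriv_succ, iteratedDeriv_one, deriv_cauchyWitness]
  have h : HasDerivAt (fun z : ℂ => ((E₀ / α ^ 2 : ℝ) : ℂ) * (2 * z)) (((E₀ / α ^ 2 : ℝ) : ℂ) * (2 * 1)) (0 : ℂ) := by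
    have h1 : HasDerivAt (fun z : ℂ => 2 * z) (2 * 1) (0 : ℂ) := (hasDerivAt_id (0 : ℂ)).const_mul 2
    exact h1.const_mul _
  rw [h.deriv]
  push_cast
  ring

/-- The norm of the witness's second derivative at `0` is exactly Cauchy's bound `2E₀/α²`. -/
theorem norm_iteratedDeriv_two_cauchyWitness {E₀ α : ℝ} (hE : 0 ≤ E₀) (hα : 0 < α) :
    ‖iteratedDeriv 2 (cauchyWitness E₀ α) 0‖ = 2 * E₀ / α ^ 2 := by
  rw [iteratedDeriv_two_cauchyWitness, Complex.norm_real, Real.norm_eq_abs, abs_of_nonneg (by positivity)]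

/-! ## §2 Any read-out rule valid on the class is at least Cauchy's value -/

/-- [folklore] A «read-out rule» `Φ`: a bound on the second derivative at the centre, valid for EVERY entire function whose sup on
the closed ball of radius `α` is at most `E₀`.  (This is the only information an (I.1.18)-type inductive bound carries
about a term of the effective action in the field direction.) -/
def IsReadoutBound (Φ : ℝ → ℝ → ℝ) : Prop :=
  ∀ (E₀ α : ℝ), 0 ≤ E₀ → 0 < α → ∀ f : ℂ → ℂ, AnalyticOnNhd ℂ f Set.univ →
    (∀ z : ℂ, ‖z‖ ≤ α → ‖f z‖ ≤ E₀) → ‖iteratedDeriv 2 f 0‖ ≤ Φ E₀ α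

/-- **Cauchy sharpness.**  Every read-out rule is bounded BELOW by `2E₀/α²` — no cleverness in using a sup bound on a
ball can beat the inverse square of the radius. -/
theorem readoutBound_ge {Φ : ℝ → ℝ → ℝ} (hΦ : IsReadoutBound Φ) {E₀ α : ℝ} (hE : 0 ≤ E₀) (hα : 0 < α) :
    2 * E₀ / α ^ 2 ≤ Φ E₀ α := by
  have h := hΦ E₀ α hE hα (cauchyWitness E₀ α) (analyticOnNhd_cauchyWitness E₀ α)
    (fun z hz => norm_cauchyWitness_le hE hα hz)
  rwa [norm_iteratedDeriv_two_cauchyWitness hE hα] at h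

/-! ## §3 [III]'s letters: radii (2.28) proportional to the coupling make the sharp value blow up

`B14.alphaJ C₀ q₀ g = g * C₀ * (log (g²)⁻¹) ^ q₀` is the typed (2.28).  A «budget of the printed shape» for the sup bound is
`budget c p g = g * c * (log (g²)⁻¹) ^ p`: `p = 0, c = E₀` is (I.1.18) itself; `c·(log g⁻²)^{3p₀}` times the explicit `g`
is [III] p. 278's «B₀ replaced by O(p₀³(g_k)) … multiplication by g_k».  The parametrisation `g = exp(−x/2)`
(`x = log g⁻²`) turns the sharp value `2·budget/α²` into `(2c/C₀²)·e^{x/2}·x^p/x^{2q₀}`, which tends to `+∞`. -/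

/-- A sup-bound budget of the printed shape `g ↦ g·c·(log g⁻²)^p`. -/
def budget (c : ℝ) (p : ℕ) (g : ℝ) : ℝ := g * c * (Real.log (g ^ 2)⁻¹) ^ p

/-- The sharp Cauchy value `2·E₀/α²` fed with [III]'s budget and radius. -/
def sharpRatio (C₀ c : ℝ) (q₀ p : ℕ) (g : ℝ) : ℝ := 2 * budget c p g / (B14.alphaJ C₀ q₀ g) ^ 2

/-- Under `g = exp(−x/2)` one has `log (g²)⁻¹ = x`. -/
theorem log_inv_sq_exp (x : ℝ) : Real.log ((Real.exp (-x / 2)) ^ 2)⁻¹ = x := by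
  rw [← Real.exp_nat_mul, ← Real.exp_neg, Real.log_exp]
  ring

/-- The sharp value along the parametrisation `g = exp(−x/2)`, `x > 0`:
`sharpRatio = (2c/C₀²) · exp(x/2) · x^p / x^(2q₀)`. -/
theorem sharpRatio_eq_param {C₀ : ℝ} (hC₀ : C₀ ≠ 0) (c : ℝ) (q₀ p : ℕ) {x : ℝ} (hx : 0 < x) :
    sharpRatio C₀ c q₀ p (Real.exp (-x / 2)) = 2 * c / C₀ ^ 2 * Real.exp (x / 2) * x ^ p / x ^ (2 * q₀) := by
  unfold sharpRatio budget B14.alphaJ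
  rw [log_inv_sq_exp]
  have hx0 : x ≠ 0 := hx.ne'
  have hexp : Real.exp (x / 2) ≠ 0 := (Real.exp_pos _).ne'
  have hneg : Real.exp (-x / 2) = (Real.exp (x / 2))⁻¹ := by
    rw [← Real.exp_neg]; congr 1; ring
  rw [hneg]
  field_simp
  ring

/-- The parametrised sharp value tends to `+∞` (for `c > 0`, `C₀ ≠ 0`, any `p`, `q₀`). -/
theorem tendsto_sharpRatio_param {C₀ c : ℝ} (hC₀ : C₀ ≠ 0) (hc : 0 < c) (q₀ p : ℕ) :
    Tendsto (fun x : ℝ => 2 * c / C₀ ^ 2 * Real.exp (x / 2) * x ^ p / x ^ (2 * q₀)) atTop atTop := by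
  -- the engine: exp(y)/y^(2q₀) → ∞ along y = x/2
  have hK : 0 < 2 * c / C₀ ^ 2 / 2 ^ (2 * q₀) := by positivity
  have h1 : Tendsto (fun x : ℝ => Real.exp (x / 2) / (x / 2) ^ (2 * q₀)) atTop atTop :=
    (Real.tendsto_exp_div_pow_atTop (2 * q₀)).comp (tendsto_id.atTop_div_const (by norm_num : (0 : ℝ) < 2))
  have h2 : Tendsto (fun x : ℝ => 2 * c / C₀ ^ 2 / 2 ^ (2 * q₀) * (Real.exp (x / 2) / (x / 2) ^ (2 * q₀)))
      atTop atTop := h1.const_mul_atTop hK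
  refine tendsto_atTop_mono' atTop ?_ h2
  filter_upwards [eventually_ge_atTop (1 : ℝ)] with x hx
  have hx0 : 0 < x := by linarith
  have hxp : 1 ≤ x ^ p := one_le_pow₀ hx
  have hpow : (x / 2) ^ (2 * q₀) = x ^ (2 * q₀) / 2 ^ (2 * q₀) := by rw [div_pow]
  rw [hpow]
  have hx2 : 0 < x ^ (2 * q₀) := by positivity
  have h22 : (0 : ℝ) < 2 ^ (2 * q₀) := by positivity
  rw [div_div_eq_mul_div]
  -- LHS = K/2^{2q₀} * (exp(x/2) * 2^{2q₀} / x^{2q₀}) = K * exp(x/2) / x^{2q₀} ≤ K * exp(x/2) * x^p / x^{2q₀}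
  have hL : 2 * c / C₀ ^ 2 / 2 ^ (2 * q₀) * (Real.exp (x / 2) * 2 ^ (2 * q₀) / x ^ (2 * q₀)) =
      2 * c / C₀ ^ 2 * Real.exp (x / 2) / x ^ (2 * q₀) := by
    field_simp
  rw [hL]
  have hK' : 0 ≤ 2 * c / C₀ ^ 2 * Real.exp (x / 2) := by positivity
  calc 2 * c / C₀ ^ 2 * Real.exp (x / 2) / x ^ (2 * q₀)
      = 2 * c / C₀ ^ 2 * Real.exp (x / 2) * 1 / x ^ (2 * q₀) := by rw [mul_one]
    _ ≤ 2 * c / C₀ ^ 2 * Real.exp (x / 2) * x ^ p / x ^ (2 * q₀) := by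
        gcongr

/-- **[III]'s radii make the sharp value unbounded**: for every `B` there is `g₀ ∈ ]0,1[` such that
`sharpRatio C₀ c q₀ p g > B` for all `g ∈ ]0, g₀[`. -/
theorem sharpRatio_unbounded {C₀ c : ℝ} (hC₀ : C₀ ≠ 0) (hc : 0 < c) (q₀ p : ℕ) (B : ℝ) :
    ∃ g₀ : ℝ, 0 < g₀ ∧ g₀ < 1 ∧ ∀ g : ℝ, 0 < g → g < g₀ → B < sharpRatio C₀ c q₀ p g := by
  have ht := tendsto_sharpRatio_param hC₀ hc q₀ p
  obtain ⟨X, hX⟩ := (tendsto_atTop_atTop.1 ht) (B + 1)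
  set X' : ℝ := max X 1 with hX'
  have hX'pos : 0 < X' := lt_of_lt_of_le zero_lt_one (le_max_right _ _)
  refine ⟨Real.exp (-X' / 2), Real.exp_pos _, ?_, fun g hg hlt => ?_⟩
  · rw [Real.exp_lt_one_iff]; linarith
  -- write g = exp(−x/2) with x = log (g²)⁻¹ = −2 log g > X'
  set x : ℝ := -2 * Real.log g with hxdef
  have hgx : g = Real.exp (-x / 2) := by
    rw [hxdef, show -(-2 * Real.log g) / 2 = Real.log g by ring, Real.exp_log hg]
  have hxX : X' < x := by
    have := Real.log_lt_log hg hlt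
    rw [Real.log_exp] at this
    rw [hxdef]; linarith
  have hx0 : 0 < x := lt_trans hX'pos hxX
  have hXx : X ≤ x := le_trans (le_max_left _ _) hxX.le
  have := hX x hXx
  rw [hgx, sharpRatio_eq_param hC₀ c q₀ p hx0]
  linarith

/-! ## §4 The no-go in one sentence -/

/-- For `0 < g < 1` the printed radius (2.28) is positive when `C₀ > 0`. -/
theorem alphaJ_pos {C₀ : ℝ} (hC₀ : 0 < C₀) (q₀ : ℕ) {g : ℝ} (hg : 0 < g) (hg1 : g < 1) :
    0 < B14.alphaJ C₀ q₀ g := by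
  unfold B14.alphaJ
  have hlog : 0 < Real.log (g ^ 2)⁻¹ := by
    rw [Real.log_inv]
    have : Real.log (g ^ 2) < 0 := Real.log_neg (by positivity) (by nlinarith)
    linarith
  positivity

/-- For `0 < g < 1` a budget of the printed shape is non-negative when `c ≥ 0`. -/
theorem budget_nonneg {c : ℝ} (hc : 0 ≤ c) (p : ℕ) {g : ℝ} (hg : 0 < g) (hg1 : g < 1) : 0 ≤ budget c p g := by
  unfold budget
  have hlog : 0 < Real.log (g ^ 2)⁻¹ := by
    rw [Real.log_inv]
    have : Real.log (g ^ 2) < 0 := Real.log_neg (by positivity) (by nlinarith)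
    linarith
  positivity

/-- **NO-GO FOR THE LITERAL B14 ROAD.**  Let `Φ` be ANY read-out rule valid on the class «entire, sup ≤ E₀ on the closed
ball of radius α» (this is all that (I.1.18)-type bounds say about a term in the field direction).  Feed it [III]'s data:
the radius `α_{0}(g) = g·C₀·(log g⁻²)^{q₀}` of (2.28) p. 259 and a sup budget `E₀(g) = g·c·(log g⁻²)^p` of the printed
shape (p. 278 l. 16: «B₀ replaced by O(p₀³(g_k)) … multiplication by g_k»; or p = 0).  Then the resulting bound on the
two-derivative read-out — the (1.22)/(3.50) definition of β — is NOT bounded as `g → 0⁺`: for every `B` it exceeds `B`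
on a whole interval `]0, g₀[`.  In particular no k-uniform bound on β_{k+1}, and a fortiori none below
`B12Normalization.stepBal N Lc`, follows from [III]'s printed estimates along a flow with `g_k → 0`. -/
theorem no_uniform_readout_from_B14_bounds {Φ : ℝ → ℝ → ℝ} (hΦ : IsReadoutBound Φ)
    {C₀ c : ℝ} (hC₀ : 0 < C₀) (hc : 0 < c) (q₀ p : ℕ) (B : ℝ) :
    ∃ g₀ : ℝ, 0 < g₀ ∧ g₀ < 1 ∧
      ∀ g : ℝ, 0 < g → g < g₀ → B < Φ (budget c p g) (B14.alphaJ C₀ q₀ g) := by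
  obtain ⟨g₀, hg₀, hg₀1, h⟩ := sharpRatio_unbounded hC₀.ne' hc q₀ p B
  refine ⟨g₀, hg₀, hg₀1, fun g hg hlt => ?_⟩
  have hg1 : g < 1 := lt_trans hlt hg₀1
  have hge := readoutBound_ge hΦ (budget_nonneg hc.le p hg hg1) (alphaJ_pos hC₀ q₀ hg hg1)
  have := h g hg hlt
  unfold sharpRatio at this
  linarith

/-- The same with the quantifiers in the «no uniform bound» order: there is NO constant `B` bounding the read-out rule's
output on any interval `]0, γ[` of couplings. -/
theorem not_exists_uniform_bound {Φ : ℝ → ℝ → ℝ} (hΦ : IsReadoutBound Φ)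
    {C₀ c : ℝ} (hC₀ : 0 < C₀) (hc : 0 < c) (q₀ p : ℕ) {γ : ℝ} (hγ : 0 < γ) :
    ¬ ∃ B : ℝ, ∀ g : ℝ, 0 < g → g ≤ γ → Φ (budget c p g) (B14.alphaJ C₀ q₀ g) ≤ B := by
  rintro ⟨B, hB⟩
  obtain ⟨g₀, hg₀, _, h⟩ := no_uniform_readout_from_B14_bounds hΦ hC₀ hc q₀ p B
  -- pick g below both g₀ and γ
  set g : ℝ := min g₀ γ / 2 with hgdef
  have hgpos : 0 < g := by rw [hgdef]; positivity
  have hglt : g < g₀ := by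
    rw [hgdef]; have := min_le_left g₀ γ; linarith
  have hgle : g ≤ γ := by
    rw [hgdef]; have := min_le_right g₀ γ; linarith
  exact absurd (hB g hgpos hgle) (not_le.mpr (h g hgpos hglt))

end

end Summit.QuantumFields.BalabanUV.Beta.B14LiteralNoGo
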